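import Literature.NumberTheory.NumberFields.CyclotomicFieldFourValuations
import Literature.NumberTheory.NumberFields.EisensteinFieldPrimes
import Mathlib.Tactic.NormNum.Prime
import HarnessLib

/-!
# The Eisenstein valuation table of the `5`-descent of `E_{-37/152}` over `ℚ(ζ₃)`: five places, six Kummer values

PROOF-ONLY file (theorems only, no definition, no named fact, no `sorry`), topic `NumberTheory/EllipticCurves`;
the arithmetic input of the instance `KubertTateM37152EisensteinDescent` — the SECOND complete `5`-descent over `ℚ(ζ₃)`
with SPLIT primes (after `KubertTate1314EisensteinDescent`), and the first whose `ℚ(ζ₃)`-points are NOT `ℤ[ζ₃]`-integral: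
they are the twist points `u = -71041/3`, `-42883/3` of `-3Y² = g(u)` themselves (3-adically non-integral abscissae,
`η = Y√-3 = Y(1 + 2ζ₃)`), read on `E_{-37/152} = [189, 5624, 854848, 0, 0]` as `Q = (u, (η − 189u − 854848)/2)`.
Carrier: the tree's model `K3` (`mkInt a b = a + bζ₃`).  `mn = -5624 = -2³·19·37` with `19, 37 ≡ 1 (mod 3)` SPLIT and `2`
inert: places `v₀ = (2)`, `v₁ = (2 − 3ζ₃)`, `v₂ = (5 + 3ζ₃)` (norm `19`), `v₃ = (3 − 4ζ₃)`, `v₄ = (7 + 4ζ₃)` (norm `37`).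
Since the Kummer values `f_T = xy − 152x² + 152²y` of `Q₁, Q₂` have denominator `27 = 3³` (a unit at all five places),
this file tabulates the orders of the INTEGRAL numerators `27·f_T(P)` for `P₀ = −T = (0, -854848)`, `P₁ = (-830, 4700)`,
`P₂ = (-2964, 64980)`, `P₃ = Q₁`, `P₄ = Q₂` (`log_valuation_points`; the sequel divides by `27`), and of the base value
`f_T(2T) = -1170286912 = (-37)³·152²` (`log_valuation_base`), Mathlib normalisation `log v = -ord_v`:

  `ord = [[12, 4, 4, 1, 1], [3, 0, 0, 0, 0], [4, 3, 3, 0, 0], [0, 3, 2, 0, 0], [0, 3, 2, 2, 3]]`, base `[6, 2, 2, 3, 3]`,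

each certified by an explicit factorisation `α = πᵏ·y`, `y = π·z + d`, `ℓ ∤ d ∈ ℤ` (split) or an odd coordinate (inert `2`),
checked by `mkInt` arithmetic; `natCast_not_mem_places`: `27 ∉ v_j`.  BSD is not proved by this.

## References

* [SilvermanAEC2009] J. H. Silverman, *AEC*, 2nd ed., Exercise 10.1(c), Thm. X.1.1.
* [IrelandRosen1982] K. Ireland, M. Rosen, *A Classical Introduction to Modern Number Theory*, Ch. 9 §1 Prop. 9.1.4.
-/

noncomputable section

open scoped NumberField
open NumberField Ideal IsDedekindDomain Literature.NumberTheory.NumberFields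
open Literature.NumberTheory.NumberFields.K3

namespace Literature.NumberTheory.EllipticCurves

namespace KubertTateM37152EisensteinDescent

/-! ## §1 The five places of `ℚ(ζ₃)` above `mn = -2³·19·37` -/

/-- **The places `(2)`, `(2 − 3ζ₃)`, `(5 + 3ζ₃)`, `(3 − 4ζ₃)`, `(7 + 4ζ₃)` of `ℚ(ζ₃)`** (prime elements of norms `4, 19, 19, 37, 37`).
[cite: IrelandRosen1982, Ch. 9 §1 Prop. 9.1.4] -/
theorem exists_places :
    ∃ v₀ v₁ v₂ v₃ v₄ : HeightOneSpectrum (𝓞 K3),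
      v₀.asIdeal = span {(2 : 𝓞 K3)} ∧ v₁.asIdeal = span {mkInt 2 (-3)} ∧
      v₂.asIdeal = span {mkInt 5 3} ∧ v₃.asIdeal = span {mkInt 3 (-4)} ∧
      v₄.asIdeal = span {mkInt 7 4} := by
  have p₀ : Prime (2 : 𝓞 K3) := prime_two
  have p₁ : Prime (mkInt 2 (-3)) := prime_mkInt_of_norm_eq_prime (p := 19) (by norm_num) (by norm_num)
  have p₂ : Prime (mkInt 5 3) := prime_mkInt_of_norm_eq_prime (p := 19) (by norm_num) (by norm_num)
  have p₃ : Prime (mkInt 3 (-4)) := prime_mkInt_of_norm_eq_prime (p := 37) (by norm_num) (by norm_num)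
  have p₄ : Prime (mkInt 7 4) := prime_mkInt_of_norm_eq_prime (p := 37) (by norm_num) (by norm_num)
  obtain ⟨v₀, h₀⟩ := exists_asIdeal_eq_span p₀
  obtain ⟨v₁, h₁⟩ := exists_asIdeal_eq_span p₁
  obtain ⟨v₂, h₂⟩ := exists_asIdeal_eq_span p₂
  obtain ⟨v₃, h₃⟩ := exists_asIdeal_eq_span p₃
  obtain ⟨v₄, h₄⟩ := exists_asIdeal_eq_span p₄
  exact ⟨v₀, v₁, v₂, v₃, v₄, h₀, h₁, h₂, h₃, h₄⟩

/-! ## §2 The valuation table -/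

section Table

variable {v₀ v₁ v₂ v₃ v₄ : HeightOneSpectrum (𝓞 K3)}
  (hv₀ : v₀.asIdeal = span {(2 : 𝓞 K3)}) (hv₁ : v₁.asIdeal = span {mkInt 2 (-3)})
  (hv₂ : v₂.asIdeal = span {mkInt 5 3}) (hv₃ : v₃.asIdeal = span {mkInt 3 (-4)})
  (hv₄ : v₄.asIdeal = span {mkInt 7 4})

include hv₀ hv₁ hv₂ hv₃ hv₄

/-- The rational primes `2, 19, 19, 37, 37` lie in the five places (`19 = (2 − 3ζ₃)(5 + 3ζ₃)`, `37 = (3 − 4ζ₃)(7 + 4ζ₃)`).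
[cite: IrelandRosen1982, Ch. 9 §1 Prop. 9.1.4] -/
theorem natCast_mem_places :
    ((2 : ℕ) : 𝓞 K3) ∈ v₀.asIdeal ∧ ((19 : ℕ) : 𝓞 K3) ∈ v₁.asIdeal ∧ ((19 : ℕ) : 𝓞 K3) ∈ v₂.asIdeal ∧
      ((37 : ℕ) : 𝓞 K3) ∈ v₃.asIdeal ∧ ((37 : ℕ) : 𝓞 K3) ∈ v₄.asIdeal := by
  refine ⟨?_, ?_, ?_, ?_, ?_⟩
  · rw [hv₀, mem_span_singleton]; exact ⟨1, by norm_num⟩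
  · rw [hv₁, mem_span_singleton]
    exact ⟨mkInt 5 3, by
      rw [mkInt_mul, show ((19 : ℕ) : 𝓞 K3) = ((19 : ℤ) : 𝓞 K3) by norm_cast, ← mkInt_intCast, mkInt_inj]; norm_num⟩
  · rw [hv₂, mem_span_singleton]
    exact ⟨mkInt 2 (-3), by
      rw [mkInt_mul, show ((19 : ℕ) : 𝓞 K3) = ((19 : ℤ) : 𝓞 K3) by norm_cast, ← mkInt_intCast, mkInt_inj]; norm_num⟩
  · rw [hv₃, mem_span_singleton]
    exact ⟨mkInt 7 4, by
      rw [mkInt_mul, show ((37 : ℕ) : 𝓞 K3) = ((37 : ℤ) : 𝓞 K3) by norm_cast, ← mkInt_intCast, mkInt_inj]; norm_num⟩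
  · rw [hv₄, mem_span_singleton]
    exact ⟨mkInt 3 (-4), by
      rw [mkInt_mul, show ((37 : ℕ) : 𝓞 K3) = ((37 : ℤ) : 𝓞 K3) by norm_cast, ← mkInt_intCast, mkInt_inj]; norm_num⟩

/-- `27 = 3³` is a unit at the five places (none lies above `3`). [cite: IrelandRosen1982, Ch. 9 §1 Prop. 9.1.4] -/
theorem natCast_not_mem_places : ∀ j : Fin 5, ((27 : ℤ) : 𝓞 K3) ∉ (![v₀, v₁, v₂, v₃, v₄] j).asIdeal := by
  obtain ⟨hℓ₀, hℓ₁, hℓ₂, hℓ₃, hℓ₄⟩ := natCast_mem_places hv₀ hv₁ hv₂ hv₃ hv₄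
  intro j
  fin_cases j
  · exact intCast_not_mem_of_not_dvd Nat.prime_two hℓ₀ (by norm_num)
  · exact intCast_not_mem_of_not_dvd (by norm_num) hℓ₁ (by norm_num)
  · exact intCast_not_mem_of_not_dvd (by norm_num) hℓ₂ (by norm_num)
  · exact intCast_not_mem_of_not_dvd (by norm_num) hℓ₃ (by norm_num)
  · exact intCast_not_mem_of_not_dvd (by norm_num) hℓ₄ (by norm_num)

/-- **The orders of the five numerators `27·f_T(P_i)` at the five places** for `P₀ = −T`, `P₁ = (-830, 4700)`, `P₂ = (-2964, 64980)`,
`P₃ = Q₁ = (-71041/3, 29890762/9 + (27194909/9)ζ₃)`, `P₄ = Q₂ = (-42883/3, 13291621/9 + (9962213/9)ζ₃)`: the matrix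
`[[12, 4, 4, 1, 1], [3, 0, 0, 0, 0], [4, 3, 3, 0, 0], [0, 3, 2, 0, 0], [0, 3, 2, 2, 3]]` (read as `log v = -ord`). [cite: SilvermanAEC2009, Exercise 10.1(c)] -/
theorem log_valuation_points : ∀ i j : Fin 5,
    WithZero.log ((![v₀, v₁, v₂, v₃, v₄] j).valuation K3
      ((![(mkInt (-533261021184) 0 : 𝓞 K3), (mkInt (-675000) 0 : 𝓞 K3), (mkInt (-720030384) 0 : 𝓞 K3), (mkInt (-2353032726034) (-47019997661) : 𝓞 K3), (mkInt (-487277718775) 263291327377 : 𝓞 K3)] i : 𝓞 K3) : K3)) =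
      -((![![12, 4, 4, 1, 1], ![3, 0, 0, 0, 0], ![4, 3, 3, 0, 0], ![0, 3, 2, 0, 0], ![0, 3, 2, 2, 3]] : Fin 5 → Fin 5 → ℕ) i j : ℤ) := by
  have e2 : (2 : 𝓞 K3) = mkInt 2 0 := by rw [mkInt_intCast]; norm_num
  have e2' : (2 : 𝓞 K3) = ((2 : ℤ) : 𝓞 K3) := by norm_num
  obtain ⟨hℓ₀, hℓ₁, hℓ₂, hℓ₃, hℓ₄⟩ := natCast_mem_places hv₀ hv₁ hv₂ hv₃ hv₄
  have hπ₁ : mkInt 2 (-3) ∈ v₁.asIdeal := by rw [hv₁]; exact mem_span_singleton_self _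
  have hπ₂ : mkInt 5 3 ∈ v₂.asIdeal := by rw [hv₂]; exact mem_span_singleton_self _
  have hπ₃ : mkInt 3 (-4) ∈ v₃.asIdeal := by rw [hv₃]; exact mem_span_singleton_self _
  have hπ₄ : mkInt 7 4 ∈ v₄.asIdeal := by rw [hv₄]; exact mem_span_singleton_self _
  have c00 : WithZero.log (v₀.valuation K3 ((mkInt (-533261021184) 0 : 𝓞 K3) : K3)) = -12 := by
    rw [log_valuation_eq_neg_of_eq_pow_mul hv₀ 12 (y := mkInt (-130190679) 0)
      (by rw [show (2 : 𝓞 K3) ^ 12 = (((2 : ℤ) ^ 12 : ℤ) : 𝓞 K3) by norm_num, ← mkInt_intCast, mkInt_mul, mkInt_inj]; norm_num)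
      (fun h ↦ by
        rw [hv₀, mem_span_singleton, e2', intCast_dvd_mkInt_iff] at h
        omega)]
    norm_num
  have c01 : WithZero.log (v₁.valuation K3 ((mkInt (-533261021184) 0 : 𝓞 K3) : K3)) = -4 := by
    rw [log_valuation_eq_neg_of_eq_pow_mul hv₁ 4 (y := mkInt 757002240 (-945229824))
      (by simp only [pow_succ, pow_zero, one_mul, mkInt_mul, mkInt_inj]; norm_num)
      (not_mem_of_eq_mul_add_intCast (ℓ := 19) (by norm_num) hℓ₁ hπ₁ (z := mkInt 348457928 20028792) (d := 8)
        (by rw [mkInt_mul, ← mkInt_intCast, mkInt_add, mkInt_inj]; norm_num) (by norm_num))]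
    norm_num
  have c02 : WithZero.log (v₂.valuation K3 ((mkInt (-533261021184) 0 : 𝓞 K3) : K3)) = -4 := by
    rw [log_valuation_eq_neg_of_eq_pow_mul hv₂ 4 (y := mkInt 1702232064 945229824)
      (by simp only [pow_succ, pow_zero, one_mul, mkInt_mul, mkInt_inj]; norm_num)
      (not_mem_of_eq_mul_add_intCast (ℓ := 19) (by norm_num) hℓ₂ hπ₂ (z := mkInt 328429136 (-20028792)) (d := 8)
        (by rw [mkInt_mul, ← mkInt_intCast, mkInt_add, mkInt_inj]; norm_num) (by norm_num))]
    norm_num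
  have c03 : WithZero.log (v₃.valuation K3 ((mkInt (-533261021184) 0 : 𝓞 K3) : K3)) = -1 := by
    rw [log_valuation_eq_neg_of_eq_pow_mul hv₃ 1 (y := mkInt (-100887220224) (-57649840128))
      (by simp only [pow_succ, pow_zero, one_mul, mkInt_mul, mkInt_inj]; norm_num)
      (not_mem_of_eq_mul_add_intCast (ℓ := 37) (by norm_num) hℓ₃ hπ₃ (z := mkInt (-12854356251) (-15581037876)) (d := 33)
        (by rw [mkInt_mul, ← mkInt_intCast, mkInt_add, mkInt_inj]; norm_num) (by norm_num))]
    norm_num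
  have c04 : WithZero.log (v₄.valuation K3 ((mkInt (-533261021184) 0 : 𝓞 K3) : K3)) = -1 := by
    rw [log_valuation_eq_neg_of_eq_pow_mul hv₄ 1 (y := mkInt (-43237380096) 57649840128)
      (by simp only [pow_succ, pow_zero, one_mul, mkInt_mul, mkInt_inj]; norm_num)
      (not_mem_of_eq_mul_add_intCast (ℓ := 37) (by norm_num) hℓ₄ hπ₄ (z := mkInt 2726681625 15581037876) (d := 33)
        (by rw [mkInt_mul, ← mkInt_intCast, mkInt_add, mkInt_inj]; norm_num) (by norm_num))]
    norm_num
  have c10 : WithZero.log (v₀.valuation K3 ((mkInt (-675000) 0 : 𝓞 K3) : K3)) = -3 := by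
    rw [log_valuation_eq_neg_of_eq_pow_mul hv₀ 3 (y := mkInt (-84375) 0)
      (by rw [show (2 : 𝓞 K3) ^ 3 = (((2 : ℤ) ^ 3 : ℤ) : 𝓞 K3) by norm_num, ← mkInt_intCast, mkInt_mul, mkInt_inj]; norm_num)
      (fun h ↦ by
        rw [hv₀, mem_span_singleton, e2', intCast_dvd_mkInt_iff] at h
        omega)]
    norm_num
  have c11 : WithZero.log (v₁.valuation K3 ((mkInt (-675000) 0 : 𝓞 K3) : K3)) = -0 := by
    rw [log_valuation_eq_neg_of_eq_pow_mul hv₁ 0 (y := mkInt (-675000) 0)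
      (by rw [pow_zero, one_mul])
      (not_mem_of_eq_mul_add_intCast (ℓ := 19) (by norm_num) hℓ₁ hπ₁ (z := mkInt (-177635) (-106581)) (d := 13)
        (by rw [mkInt_mul, ← mkInt_intCast, mkInt_add, mkInt_inj]; norm_num) (by norm_num))]
    norm_num
  have c12 : WithZero.log (v₂.valuation K3 ((mkInt (-675000) 0 : 𝓞 K3) : K3)) = -0 := by
    rw [log_valuation_eq_neg_of_eq_pow_mul hv₂ 0 (y := mkInt (-675000) 0)
      (by rw [pow_zero, one_mul])
      (not_mem_of_eq_mul_add_intCast (ℓ := 19) (by norm_num) hℓ₂ hπ₂ (z := mkInt (-71054) 106581) (d := 13)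
        (by rw [mkInt_mul, ← mkInt_intCast, mkInt_add, mkInt_inj]; norm_num) (by norm_num))]
    norm_num
  have c13 : WithZero.log (v₃.valuation K3 ((mkInt (-675000) 0 : 𝓞 K3) : K3)) = -0 := by
    rw [log_valuation_eq_neg_of_eq_pow_mul hv₃ 0 (y := mkInt (-675000) 0)
      (by rw [pow_zero, one_mul])
      (not_mem_of_eq_mul_add_intCast (ℓ := 37) (by norm_num) hℓ₃ hπ₃ (z := mkInt (-127708) (-72976)) (d := 28)
        (by rw [mkInt_mul, ← mkInt_intCast, mkInt_add, mkInt_inj]; norm_num) (by norm_num))]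
    norm_num
  have c14 : WithZero.log (v₄.valuation K3 ((mkInt (-675000) 0 : 𝓞 K3) : K3)) = -0 := by
    rw [log_valuation_eq_neg_of_eq_pow_mul hv₄ 0 (y := mkInt (-675000) 0)
      (by rw [pow_zero, one_mul])
      (not_mem_of_eq_mul_add_intCast (ℓ := 37) (by norm_num) hℓ₄ hπ₄ (z := mkInt (-54732) 72976) (d := 28)
        (by rw [mkInt_mul, ← mkInt_intCast, mkInt_add, mkInt_inj]; norm_num) (by norm_num))]
    norm_num
  have c20 : WithZero.log (v₀.valuation K3 ((mkInt (-720030384) 0 : 𝓞 K3) : K3)) = -4 := by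
    rw [log_valuation_eq_neg_of_eq_pow_mul hv₀ 4 (y := mkInt (-45001899) 0)
      (by rw [show (2 : 𝓞 K3) ^ 4 = (((2 : ℤ) ^ 4 : ℤ) : 𝓞 K3) by norm_num, ← mkInt_intCast, mkInt_mul, mkInt_inj]; norm_num)
      (fun h ↦ by
        rw [hv₀, mem_span_singleton, e2', intCast_dvd_mkInt_iff] at h
        omega)]
    norm_num
  have c21 : WithZero.log (v₁.valuation K3 ((mkInt (-720030384) 0 : 𝓞 K3) : K3)) = -3 := by
    rw [log_valuation_eq_neg_of_eq_pow_mul hv₁ 3 (y := mkInt (-1784592) (-9447840))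
      (by simp only [pow_succ, pow_zero, one_mul, mkInt_mul, mkInt_inj]; norm_num)
      (not_mem_of_eq_mul_add_intCast (ℓ := 19) (by norm_num) hℓ₁ hπ₁ (z := mkInt 1022130 (-1276290)) (d := 18)
        (by rw [mkInt_mul, ← mkInt_intCast, mkInt_add, mkInt_inj]; norm_num) (by norm_num))]
    norm_num
  have c22 : WithZero.log (v₂.valuation K3 ((mkInt (-720030384) 0 : 𝓞 K3) : K3)) = -3 := by
    rw [log_valuation_eq_neg_of_eq_pow_mul hv₂ 3 (y := mkInt 7663248 9447840)
      (by simp only [pow_succ, pow_zero, one_mul, mkInt_mul, mkInt_inj]; norm_num)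
      (not_mem_of_eq_mul_add_intCast (ℓ := 19) (by norm_num) hℓ₂ hπ₂ (z := mkInt 2298420 1276290) (d := 18)
        (by rw [mkInt_mul, ← mkInt_intCast, mkInt_add, mkInt_inj]; norm_num) (by norm_num))]
    norm_num
  have c23 : WithZero.log (v₃.valuation K3 ((mkInt (-720030384) 0 : 𝓞 K3) : K3)) = -0 := by
    rw [log_valuation_eq_neg_of_eq_pow_mul hv₃ 0 (y := mkInt (-720030384) 0)
      (by rw [pow_zero, one_mul])
      (not_mem_of_eq_mul_add_intCast (ℓ := 37) (by norm_num) hℓ₃ hπ₃ (z := mkInt (-136221967) (-77841124)) (d := 13)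
        (by rw [mkInt_mul, ← mkInt_intCast, mkInt_add, mkInt_inj]; norm_num) (by norm_num))]
    norm_num
  have c24 : WithZero.log (v₄.valuation K3 ((mkInt (-720030384) 0 : 𝓞 K3) : K3)) = -0 := by
    rw [log_valuation_eq_neg_of_eq_pow_mul hv₄ 0 (y := mkInt (-720030384) 0)
      (by rw [pow_zero, one_mul])
      (not_mem_of_eq_mul_add_intCast (ℓ := 37) (by norm_num) hℓ₄ hπ₄ (z := mkInt (-58380843) 77841124) (d := 13)
        (by rw [mkInt_mul, ← mkInt_intCast, mkInt_add, mkInt_inj]; norm_num) (by norm_num))]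
    norm_num
  have c30 : WithZero.log (v₀.valuation K3 ((mkInt (-2353032726034) (-47019997661) : 𝓞 K3) : K3)) = -0 := by
    rw [log_valuation_eq_neg_of_eq_pow_mul hv₀ 0 (y := mkInt (-2353032726034) (-47019997661))
      (by rw [pow_zero, one_mul])
      (fun h ↦ by
        rw [hv₀, mem_span_singleton, e2', intCast_dvd_mkInt_iff] at h
        omega)]
    norm_num
  have c31 : WithZero.log (v₁.valuation K3 ((mkInt (-2353032726034) (-47019997661) : 𝓞 K3) : K3)) = -3 := by
    rw [log_valuation_eq_neg_of_eq_pow_mul hv₁ 3 (y := mkInt (-5215010432) (-30374760973))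
      (by simp only [pow_succ, pow_zero, one_mul, mkInt_mul, mkInt_inj]; norm_num)
      (not_mem_of_eq_mul_add_intCast (ℓ := 19) (by norm_num) hℓ₁ hπ₁ (z := mkInt 3423643721 (-4020765962)) (d := 12)
        (by rw [mkInt_mul, ← mkInt_intCast, mkInt_add, mkInt_inj]; norm_num) (by norm_num))]
    norm_num
  have c32 : WithZero.log (v₂.valuation K3 ((mkInt (-2353032726034) (-47019997661) : 𝓞 K3) : K3)) = -2 := by
    rw [log_valuation_eq_neg_of_eq_pow_mul hv₂ 2 (y := mkInt 29855245649 134796031258)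
      (by simp only [pow_succ, pow_zero, one_mul, mkInt_mul, mkInt_inj]; norm_num)
      (not_mem_of_eq_mul_add_intCast (ℓ := 19) (by norm_num) hℓ₂ hπ₂ (z := mkInt 24426241318 30758653652) (d := 15)
        (by rw [mkInt_mul, ← mkInt_intCast, mkInt_add, mkInt_inj]; norm_num) (by norm_num))]
    norm_num
  have c33 : WithZero.log (v₃.valuation K3 ((mkInt (-2353032726034) (-47019997661) : 𝓞 K3) : K3)) = -0 := by
    rw [log_valuation_eq_neg_of_eq_pow_mul hv₃ 0 (y := mkInt (-2353032726034) (-47019997661))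
      (by rw [pow_zero, one_mul])
      (not_mem_of_eq_mul_add_intCast (ℓ := 37) (by norm_num) hℓ₃ hπ₃ (z := mkInt (-440085110584) (-258194348571)) (d := 2)
        (by rw [mkInt_mul, ← mkInt_intCast, mkInt_add, mkInt_inj]; norm_num) (by norm_num))]
    norm_num
  have c34 : WithZero.log (v₄.valuation K3 ((mkInt (-2353032726034) (-47019997661) : 𝓞 K3) : K3)) = -0 := by
    rw [log_valuation_eq_neg_of_eq_pow_mul hv₄ 0 (y := mkInt (-2353032726034) (-47019997661))
      (by rw [pow_zero, one_mul])
      (not_mem_of_eq_mul_add_intCast (ℓ := 37) (by norm_num) hℓ₄ hπ₄ (z := mkInt (-195869680238) 245486241097) (d := 20)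
        (by rw [mkInt_mul, ← mkInt_intCast, mkInt_add, mkInt_inj]; norm_num) (by norm_num))]
    norm_num
  have c40 : WithZero.log (v₀.valuation K3 ((mkInt (-487277718775) 263291327377 : 𝓞 K3) : K3)) = -0 := by
    rw [log_valuation_eq_neg_of_eq_pow_mul hv₀ 0 (y := mkInt (-487277718775) 263291327377)
      (by rw [pow_zero, one_mul])
      (fun h ↦ by
        rw [hv₀, mem_span_singleton, e2', intCast_dvd_mkInt_iff] at h
        omega)]
    norm_num
  have c41 : WithZero.log (v₁.valuation K3 ((mkInt (-487277718775) 263291327377 : 𝓞 K3) : K3)) = -3 := by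
    rw [log_valuation_eq_neg_of_eq_pow_mul hv₁ 3 (y := mkInt (-4662478595) (-9195985069))
      (by simp only [pow_succ, pow_zero, one_mul, mkInt_mul, mkInt_inj]; norm_num)
      (not_mem_of_eq_mul_add_intCast (ℓ := 19) (by norm_num) hℓ₁ hπ₁ (z := mkInt 225029588 (-1704179261)) (d := 12)
        (by rw [mkInt_mul, ← mkInt_intCast, mkInt_add, mkInt_inj]; norm_num) (by norm_num))]
    norm_num
  have c42 : WithZero.log (v₂.valuation K3 ((mkInt (-487277718775) 263291327377 : 𝓞 K3) : K3)) = -2 := by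
    rw [log_valuation_eq_neg_of_eq_pow_mul hv₂ 2 (y := mkInt 22065114872 40015216987)
      (by simp only [pow_succ, pow_zero, one_mul, mkInt_mul, mkInt_inj]; norm_num)
      (not_mem_of_eq_mul_add_intCast (ℓ := 19) (by norm_num) hℓ₂ hπ₂ (z := mkInt 8640835825 7046354756) (d := 15)
        (by rw [mkInt_mul, ← mkInt_intCast, mkInt_add, mkInt_inj]; norm_num) (by norm_num))]
    norm_num
  have c43 : WithZero.log (v₃.valuation K3 ((mkInt (-487277718775) 263291327377 : 𝓞 K3) : K3)) = -2 := by
    rw [log_valuation_eq_neg_of_eq_pow_mul hv₃ 2 (y := mkInt (-19438873495) (-15583745831))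
      (by simp only [pow_succ, pow_zero, one_mul, mkInt_mul, mkInt_inj]; norm_num)
      (not_mem_of_eq_mul_add_intCast (ℓ := 37) (by norm_num) hℓ₃ hπ₃ (z := mkInt (-1992895437) (-3365046797)) (d := 4)
        (by rw [mkInt_mul, ← mkInt_intCast, mkInt_add, mkInt_inj]; norm_num) (by norm_num))]
    norm_num
  have c44 : WithZero.log (v₄.valuation K3 ((mkInt (-487277718775) 263291327377 : 𝓞 K3) : K3)) = -3 := by
    rw [log_valuation_eq_neg_of_eq_pow_mul hv₄ 3 (y := mkInt 3051086443 2793273239)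
      (by simp only [pow_succ, pow_zero, one_mul, mkInt_mul, mkInt_inj]; norm_num)
      (not_mem_of_eq_mul_add_intCast (ℓ := 37) (by norm_num) hℓ₄ hπ₄ (z := mkInt 549360872 198609917) (d := 7)
        (by rw [mkInt_mul, ← mkInt_intCast, mkInt_add, mkInt_inj]; norm_num) (by norm_num))]
    norm_num
  intro i j
  fin_cases i <;> fin_cases j
  · simpa using c00
  · simpa using c01
  · simpa using c02
  · simpa using c03
  · simpa using c04
  · simpa using c10
  · simpa using c11
  · simpa using c12
  · simpa using c13
  · simpa using c14
  · simpa using c20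
  · simpa using c21
  · simpa using c22
  · simpa using c23
  · simpa using c24
  · simpa using c30
  · simpa using c31
  · simpa using c32
  · simpa using c33
  · simpa using c34
  · simpa using c40
  · simpa using c41
  · simpa using c42
  · simpa using c43
  · simpa using c44

/-- **The orders of the base value `f_T(2T) = -1170286912 = -2⁶·19²·37³` at the five places**: `[6, 2, 2, 3, 3]`.
[cite: SilvermanAEC2009, Exercise 10.1(c)] -/
theorem log_valuation_base : ∀ j : Fin 5,
    WithZero.log ((![v₀, v₁, v₂, v₃, v₄] j).valuation K3 (((mkInt (-1170286912) 0 : 𝓞 K3) : 𝓞 K3) : K3)) =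
      -((![6, 2, 2, 3, 3] : Fin 5 → ℕ) j : ℤ) := by
  have e2 : (2 : 𝓞 K3) = mkInt 2 0 := by rw [mkInt_intCast]; norm_num
  have e2' : (2 : 𝓞 K3) = ((2 : ℤ) : 𝓞 K3) := by norm_num
  obtain ⟨hℓ₀, hℓ₁, hℓ₂, hℓ₃, hℓ₄⟩ := natCast_mem_places hv₀ hv₁ hv₂ hv₃ hv₄
  have hπ₁ : mkInt 2 (-3) ∈ v₁.asIdeal := by rw [hv₁]; exact mem_span_singleton_self _
  have hπ₂ : mkInt 5 3 ∈ v₂.asIdeal := by rw [hv₂]; exact mem_span_singleton_self _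
  have hπ₃ : mkInt 3 (-4) ∈ v₃.asIdeal := by rw [hv₃]; exact mem_span_singleton_self _
  have hπ₄ : mkInt 7 4 ∈ v₄.asIdeal := by rw [hv₄]; exact mem_span_singleton_self _
  have c50 : WithZero.log (v₀.valuation K3 ((mkInt (-1170286912) 0 : 𝓞 K3) : K3)) = -6 := by
    rw [log_valuation_eq_neg_of_eq_pow_mul hv₀ 6 (y := mkInt (-18285733) 0)
      (by rw [show (2 : 𝓞 K3) ^ 6 = (((2 : ℤ) ^ 6 : ℤ) : 𝓞 K3) by norm_num, ← mkInt_intCast, mkInt_mul, mkInt_inj]; norm_num)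
      (fun h ↦ by
        rw [hv₀, mem_span_singleton, e2', intCast_dvd_mkInt_iff] at h
        omega)]
    norm_num
  have c51 : WithZero.log (v₁.valuation K3 ((mkInt (-1170286912) 0 : 𝓞 K3) : K3)) = -2 := by
    rw [log_valuation_eq_neg_of_eq_pow_mul hv₁ 2 (y := mkInt (-51868672) (-68077632))
      (by simp only [pow_succ, pow_zero, one_mul, mkInt_mul, mkInt_inj]; norm_num)
      (not_mem_of_eq_mul_add_intCast (ℓ := 19) (by norm_num) hℓ₁ hπ₁ (z := mkInt (-2900551) (-15355857)) (d := 1)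
        (by rw [mkInt_mul, ← mkInt_intCast, mkInt_add, mkInt_inj]; norm_num) (by norm_num))]
    norm_num
  have c52 : WithZero.log (v₂.valuation K3 ((mkInt (-1170286912) 0 : 𝓞 K3) : K3)) = -2 := by
    rw [log_valuation_eq_neg_of_eq_pow_mul hv₂ 2 (y := mkInt 16208960 68077632)
      (by simp only [pow_succ, pow_zero, one_mul, mkInt_mul, mkInt_inj]; norm_num)
      (not_mem_of_eq_mul_add_intCast (ℓ := 19) (by norm_num) hℓ₂ hπ₂ (z := mkInt 12455306 15355857) (d := 1)
        (by rw [mkInt_mul, ← mkInt_intCast, mkInt_add, mkInt_inj]; norm_num) (by norm_num))]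
    norm_num
  have c53 : WithZero.log (v₃.valuation K3 ((mkInt (-1170286912) 0 : 𝓞 K3) : K3)) = -3 := by
    rw [log_valuation_eq_neg_of_eq_pow_mul hv₃ 3 (y := mkInt (-1640384) (-5822208))
      (by simp only [pow_succ, pow_zero, one_mul, mkInt_mul, mkInt_inj]; norm_num)
      (not_mem_of_eq_mul_add_intCast (ℓ := 37) (by norm_num) hℓ₃ hπ₃ (z := mkInt 319081 (-649412)) (d := 21)
        (by rw [mkInt_mul, ← mkInt_intCast, mkInt_add, mkInt_inj]; norm_num) (by norm_num))]
    norm_num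
  have c54 : WithZero.log (v₄.valuation K3 ((mkInt (-1170286912) 0 : 𝓞 K3) : K3)) = -3 := by
    rw [log_valuation_eq_neg_of_eq_pow_mul hv₄ 3 (y := mkInt 4181824 5822208)
      (by simp only [pow_succ, pow_zero, one_mul, mkInt_mul, mkInt_inj]; norm_num)
      (not_mem_of_eq_mul_add_intCast (ℓ := 37) (by norm_num) hℓ₄ hπ₄ (z := mkInt 968493 649412) (d := 21)
        (by rw [mkInt_mul, ← mkInt_intCast, mkInt_add, mkInt_inj]; norm_num) (by norm_num))]
    norm_num
  intro j
  fin_cases j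
  · simpa using c50
  · simpa using c51
  · simpa using c52
  · simpa using c53
  · simpa using c54

end Table

end KubertTateM37152EisensteinDescent

end Literature.NumberTheory.EllipticCurves

end
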